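import Summits.AtomisticToContinuum.BoseEinsteinCondensation.Theses.BECDyadicChaining
import Summits.AtomisticToContinuum.BoseEinsteinCondensation.Theorems.BECDyadicChainingDyadicCoherenceDefectLevelIncrement
import Summits.AtomisticToContinuum.BoseEinsteinCondensation.Theorems.BECDyadicChainingDyadicCoherenceDefectZeroScatteringEnergy
import Summits.AtomisticToContinuum.BoseEinsteinCondensation.Theorems.BECDyadicChainingDyadicCoherenceDefectFreeAssembly
import Summits.AtomisticToContinuum.BoseEinsteinCondensation.Theorems.BECDyadicChainingDyadicCoherenceDefectDefectPerturbation
import Summits.AtomisticToContinuum.BoseEinsteinCondensation.Theorems.BECDyadicChainingDyadicCoherenceDefectFreeDirichletGap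
import Summits.AtomisticToContinuum.BoseEinsteinCondensation.Theorems.BECDyadicChainingDyadicCoherenceDefectFreeDirichletEnergy
import Summits.AtomisticToContinuum.BoseEinsteinCondensation.Theorems.BECDyadicChainingDyadicCoherenceDefectBlockKineticBound
import Summits.AtomisticToContinuum.BoseEinsteinCondensation.Theorems.BECDyadicChainingDyadicCoherenceDefectKineticBudget
import Summits.AtomisticToContinuum.BoseEinsteinCondensation.Theorems.BECDyadicChainingDyadicCoherenceDefectKineticWindowBudget
import Summits.AtomisticToContinuum.BoseEinsteinCondensation.Theorems.BECDyadicChainingDyadicCoherenceDefectPowerLawSuffices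
import Summits.AtomisticToContinuum.BoseEinsteinCondensation.Theorems.BECDyadicChainingDyadicCoherenceDefectReduction

/-!
# Line `registered` — crux `DyadicCoherenceDefect` (stmt-AtomisticToContinuum-13192), route `BECDyadicChaining`
# Lead's skeleton, reshaped by lead c2 (2026-08-17): THE KINETIC WINDOW

The crux (rank 2 of `route-AtomisticToContinuum-BECDyadicChaining`): for every repulsive finite-range
`v` there are `ℓ_d > 0`, `ρ₀ > 0` such that for `0 < ρ < ρ₀` ONE budget `β : ℕ → [0,∞)`,
`Σ_j β_j ≤ 1/4`, controls, for all large `N`, some `δ > 0` and every `δ`-near-minimiser `Ψ` of the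
Dirichlet box of side `L = (N/ρ)^{1/3}`, the per-level COHERENCE DEFECT of the dyadic block
condensates: `A_m ≤ A_{m-1} + β_j √N` whenever the cube side `L/2^m` lies in the bracket
`[ℓ_d 2^j, ℓ_d 2^{j+1})`, where `A_m = 8^{-m/2} Σ_{C ∈ level m} √⟨φ_C, γ_Ψ φ_C⟩`.

## The line after the c2 reshape: window ∪ above-window, the window now PURELY KINETIC

Write `a = scatteringLength v` (finite for repulsive finite-range `v`), `T_m = Σ_{C ∈ level m} ⟨φ_C, γ_Ψ φ_C⟩`
(`T_0 = n₀` = occupation of the box's flat mode), `K(Ψ) = ∫ |∇Ψ|²`.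

* Lead c1 (waves 1–2, all LANDED `--supports stmt-13192`): S2 `stub_levelIncrement` (p144089:
  `T_{m-1} ≤ T_m ≤ N`, `A_m ≤ A_{m-1} + √(T_m − T_{m-1})`), the free-gas half S1b = `FreeCoherenceDefect`
  (a = 0, ALL levels: G p147597 + Literature p145685 p147082 p147446, U p146910 p148928, D1 p145542, DP p145905,
  D p145661). c1's window half (S4 p144163: `LevelIncrement → WindowLocalCondensation → DefectInWindow`) hung on
  the route item `WindowLocalCondensation` (stmt-13194, XL, not in print); c1 ended `promote-stub` on S1a.
* Lead c2 (this reshape): the window is moved DOWN to the kinetic (Neumann–Poincaré) window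
  `s = L/2^m ≤ c₀ (ρa)^{-1/2}` (`≈ 0.1 ξ`, `ξ = (8πρa)^{-1/2}`), where it is a theorem of in-tree results:
  - K `stub_blockKineticBound` (LANDED p151816, from BaseCoherentMass's landed `stub_blockMassCapture`):
    `N ≤ T_k + (L/(π 2^k))² K(Ψ)` for every level `k` (sharp Neumann gap of each cube, slice-wise, Bose symmetry);
    with `T_m ≤ N` it bounds the Haar band: `T_m − T_{m-1} ≤ N − T_{m-1} ≤ (L/(π2^{m-1}))² K(Ψ)`;
  - E `stub_kineticBudget` (LANDED p152151, wave 3): `K(Ψ) ≤ energy ≤ E₀ + 1 ≤ 4πaρ(1+μ)N` eventually, for `1`-near-minimisers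
    at small density (Dyson's upper bound `eventually_groundStateEnergy_le_dyson`, `v ≥ 0`);
  - KB `stub_kineticWindowBudget` (LANDED p152920, wave 3): `LevelIncrement → BlockKineticBound → KineticBudget →
    DefectInKineticWindow`: per window level `defect_m ≤ √(T_m − T_{m-1}) ≤ (2s/π)√(4πaρ(1+μ)) √N = 4s√(aρ(1+μ)/π) √N`,
    bracket budget `β_j = 8 ℓ_d 2^j √(aρ(1+μ)/π)` on the brackets with `ℓ_d 2^j ≤ c₀(ρa)^{-1/2}`, zero above:
    `Σ_j β_j ≤ 16 c₀ √((1+μ)/π) < b'` for any `b' > 16c₀/√π` (choice of `μ`);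
  - S1″ `stub_haarBandAboveKineticWindow` (XL/OPEN, the crux's content, held by the lead): for `a > 0` there are
    `c₀ > 0`, `b ≥ 0` with `10 c₀ + b < 1/4` and a bracket base `ℓ_d > 0` such that at small density ONE summable
    budget `Σ β ≤ b` gives `√(T_m − T_{m-1}) ≤ β_j √N` on every level with `c₀(ρa)^{-1/2} < L/2^m`, uniformly in `N`
    (the Haar-band = scale-resolved depletion profile of Dirichlet near-minimisers above `≈ 0.1ξ`). Bogoliubov
    (c1 numerics, torus): `Σ_{s ≥ ξ/8} √((T_m−T_{m-1})/N) = 0.34 / 0.19 / 0.106` at `ρa³ = 10⁻⁴ / 10⁻⁵ / 10⁻⁶`,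
    `∝ (ρa³)^{1/4}` — true with room as `ρ → 0`; FALSE at `a = 0` (free ground state `∏ sin`), whence the split.
  Composition `DyadicCoherenceDefect_of_stubs : S1″ → DyadicCoherenceDefect` (sorry-free; after wave 3 its ONLY
  hypothesis is the open stub S1″): `a = 0` → S1b; `a > 0` → S1″ on the levels above `c₀(ρa)^{-1/2}` (T-form → defect
  by S2) and KB below, budgets `b + (1/4 − b)` (`16/√π < 10`).
  - P `PowerLawHaarBand` (a cleaner SUFFICIENT form of S1″ for an engine: `T_m − T_{m-1} ≤ ε (s_*/s_m)^α N` above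
    `s_* = c₀(ρa)^{-1/2}` with `ε → 0` as `ρ → 0`; the wall layer forces `α < 2`) and the glue PS `stub_powerLawSuffices :
    P → S1″` (LANDED p154043, wave 4), so `DyadicCoherenceDefect_of_powerLaw : P → DyadicCoherenceDefect` is sorry-free.

## Honesty (lead c2, sorry-free below): S1″ ALONE is target-strength

`zeroMode_of_haarBandAboveKineticWindow : S1″ → KineticBudget → X_B1-form (c = 1/2)` for every admissible `v`
with `a > 0`: the kinetic window certifies `T_{m₀-1} ≥ 3N/4` at the first window level `m₀` (K + E, `c₀ < 1/40`),
and S1″ telescopes `T_{m₀-1} − n₀ ≤ N (Σβ)² ≤ N/16`. So the line has reduced the crux to ONE open stub which is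
at least the route's target `ZeroModeOccupation` (stmt-0686) in strength (it is BEC into the flat mode, resolved
scale by scale with a summable √-profile) — an honest terminal reduction, not a proof strategy for S1″.

## Lead c3 (2026-08-17): the composition and the hardness certificates are TREE THEOREMS; the line is dead

* LANDED p156875 `Theorems/BECDyadicChainingDyadicCoherenceDefectReduction.lean` (`--supports stmt-13192`; the composition
  registered as the piece `dyadicCoherenceDefect_of_haarBandAboveKineticWindow` by `stub-add`):
  - `dyadicCoherenceDefect_of_haarBandAboveKineticWindow : (S1″ signature) → BECDyadicChaining.DyadicCoherenceDefect` — so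
    `DyadicCoherenceDefect_of_stubs` below is now ONE application, and any future proof of the S1″ signature closes the crux by `exact`;
  - `dyadicCoherenceDefect_of_powerLawHaarBand : (P signature) → DyadicCoherenceDefect`;
  - `zeroModeOccupation_of_dyadicCoherenceDefect : DyadicCoherenceDefect → ZeroModeOccupation` (X_B1, c = 1/16) and
    `boseEinsteinCondensation_of_dyadicCoherenceDefect : DyadicCoherenceDefect → BoseEinsteinCondensation` (the sub-problem
    statement), because `BaseCoherentMass` (stmt-13193) is PROVED; composed: `boseEinsteinCondensation_of_haarBandAboveKineticWindow`,
    `boseEinsteinCondensation_of_powerLawHaarBand`.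
* Consequence (machine-checked): the crux, its open stub S1″ and the sufficient form P are each at least as hard as ground-state BEC
  of the dilute 3-D Bose gas in the thermodynamic limit (LSSY2005 Ch. 5, open). The window ∪ above-window composition has nothing
  left to decompose (the above-window piece is cut-invariant, STRATEGY-CENSUS §Decomposition), and no published result bears on S1″
  (kinetic-gap engines stop at the window: barrier KineticGapLengthScales; energy methods cannot see it: barrier
  EnergyAsymptoticsWithoutCondensation). Verdict of lead c3: `line-dead: registered` (Lines/registered.dead.md) — the crux is not
  claimed false; it is the conjunct in scale-resolved form.

Disproof used: none exists for this crux (`ledger crux ls`, 2026-08-17T09Z: no Disproof.lean). Refuter crux-attack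
(EVIDENCE.md 2026-08-15): statement non-vacuous; Bogoliubov small model `Σ_levels defect/√N = 0.749√(ρa³)`.
-/

noncomputable section

open Filter MeasureTheory
open scoped ENNReal NNReal BigOperators

namespace Summit.AtomisticToContinuum.BoseEinsteinCondensation.Cruxes.DyadicCoherenceDefect.Birth

open Literature.MathematicalPhysics.QuantumManyBody.BoseGas
open Summit.AtomisticToContinuum.BoseEinsteinCondensation.Theses
open Summit.AtomisticToContinuum.BoseEinsteinCondensation.Theorems


-- BEGIN DEFS

/-- **S1″ statement — HAAR-BAND OCCUPATION ABOVE THE KINETIC WINDOW** (registered stub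
`stub_haarBandAboveKineticWindow`, XL/open: the crux's open content in LINEAR form). For `v` with POSITIVE
scattering length `a` there are a window constant `c₀ > 0`, a budget cap `b ≥ 0` with `10 c₀ + b < 1/4`, and a
bracket base `ℓ_d > 0` such that at small density the increments `T_m − T_{m-1} = tr γ_Ψ (Π_m − Π_{m-1})` of the
level occupations (`Π_m` = projection onto the functions constant on the level-`m` cubes; `Π_m − Π_{m-1}` = the
Haar band at scale `L/2^m`) satisfy `√(T_m − T_{m-1}) ≤ β_j √N` on every level with `c₀ (ρa)^{-1/2} < L/2^m`
(bracket `j`: `L/2^m ∈ [ℓ_d2^j, ℓ_d2^{j+1})`), with ONE summable budget `Σ β ≤ b` uniform in `N`. Linear in `γ_Ψ`;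
Bogoliubov heuristics `(T_m − T_{m-1})/N ≍ ln(s/ξ)/(ρ ξ s²)` (bulk phonons) `+ ξ²/(sL)` (wall layer), `s = L/2^m`;
false for `a = 0`. With the kinetic window (K, E, KB below) it gives the crux; ALONE it gives the route's target
(`zeroMode_of_haarBandAboveKineticWindow`). [cite: arXiv:2603.20776, Rem. 7; LSSY2005, §1.2 (1.17)] -/
def HaarBandAboveKineticWindow : Prop :=
  ∀ v : ℝ → ℝ≥0∞, IsRepulsiveFiniteRange v → 0 < scatteringLength v →
    ∃ c₀ b ℓd : ℝ, 0 < c₀ ∧ 0 ≤ b ∧ 10 * c₀ + b < 1 / 4 ∧ 0 < ℓd ∧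
    ∃ ρ₀ : ℝ, 0 < ρ₀ ∧ ∀ ρ : ℝ, 0 < ρ → ρ < ρ₀ →
      ∃ β : ℕ → ℝ, (∀ j, 0 ≤ β j) ∧ Summable β ∧ ∑' j, β j ≤ b ∧ ∀ᶠ N : ℕ in atTop,
        let a : ℝ := (scatteringLength v).toReal
        let L : ℝ := sideLength ρ N
        let φ : (m : ℕ) → (Fin 3 → Fin (2 ^ m)) → EuclideanSpace ℝ (Fin 3) → ℂ := fun m i =>
          Set.indicator {x : EuclideanSpace ℝ (Fin 3) | ∀ k : Fin 3, x k ∈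
              Set.Ioo (((i k : ℕ) : ℝ) * (L / 2 ^ m)) ((((i k : ℕ) : ℝ) + 1) * (L / 2 ^ m))}
            (fun _ => ((Real.sqrt ((L / 2 ^ m) ^ 3))⁻¹ : ℂ))
        ∃ δ : ℝ≥0∞, 0 < δ ∧ ∀ Ψ : TrialState N L, energy v Ψ ≤ groundStateEnergy v N L + δ →
          let T : ℕ → ℝ≥0∞ := fun m => ∑ i : Fin 3 → Fin (2 ^ m), occupation N (φ m i) Ψ.ψ
          ∀ m j : ℕ, 1 ≤ m → ℓd * 2 ^ j ≤ L / 2 ^ m → L / 2 ^ m < ℓd * 2 ^ (j + 1) →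
            c₀ * (ρ * a) ^ (-(1 : ℝ) / 2) < L / 2 ^ m →
            (T m - T (m - 1)) ^ (1 / 2 : ℝ) ≤ ENNReal.ofReal (β j) * (N : ℝ≥0∞) ^ (1 / 2 : ℝ)

/-- **K statement — BLOCK KINETIC BOUND** (stub `stub_blockKineticBound`, LANDED p151816, from
`BaseCoherentMass.stub_blockMassCapture`): for every Dirichlet trial state and every level `k`,
`N ≤ T_k + (L/(π 2^k))² ∫|∇Ψ|²` — the sharp Neumann gap `π²/s²` of each cube of side `s = L/2^k`, slice-wise
in the first particle, summed over the cubes and multiplied by `N` through Bose symmetry. With `T_{k+1} ≤ N`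
it bounds the Haar band `T_{k+1} − T_k`. [cite: LSSY2005, Ch. 5 (5.15)–(5.17)] -/
def BlockKineticBound : Prop :=
  ∀ (N : ℕ) (L : ℝ) (Ψ : TrialState N L) (k : ℕ),
    let φ : (m : ℕ) → (Fin 3 → Fin (2 ^ m)) → EuclideanSpace ℝ (Fin 3) → ℂ := fun m i =>
      Set.indicator {x : EuclideanSpace ℝ (Fin 3) | ∀ k : Fin 3, x k ∈
          Set.Ioo (((i k : ℕ) : ℝ) * (L / 2 ^ m)) ((((i k : ℕ) : ℝ) + 1) * (L / 2 ^ m))}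
        (fun _ => ((Real.sqrt ((L / 2 ^ m) ^ 3))⁻¹ : ℂ))
    (N : ℝ≥0∞) ≤ (∑ i : Fin 3 → Fin (2 ^ k), occupation N (φ k i) Ψ.ψ) +
      ENNReal.ofReal ((L / 2 ^ k) ^ 2 / Real.pi ^ 2) * ∫⁻ X, kineticDensity Ψ.ψ X

/-- **E statement — KINETIC BUDGET of near-minimisers** (stub `stub_kineticBudget`, LANDED p152151): for repulsive
finite-range `v` with `a > 0` and every `μ > 0`, at small density, for all large `N`, every Dirichlet trial
state of the box `L = (N/ρ)^{1/3}` with `energy ≤ E₀ + 1` has `∫|∇Ψ|² ≤ 4πaρ(1+μ)N`: the interaction is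
non-negative and `E₀ ≤ 4πρa(1 + C(ρa³)^{1/3})N` eventually (Dyson's upper bound). [cite: LSSY2005, Thm. 2.2 (2.14)–(2.15)] -/
def KineticBudget : Prop :=
  ∀ v : ℝ → ℝ≥0∞, IsRepulsiveFiniteRange v → 0 < scatteringLength v → ∀ μ : ℝ, 0 < μ →
    ∃ ρ₀ : ℝ, 0 < ρ₀ ∧ ∀ ρ : ℝ, 0 < ρ → ρ < ρ₀ → ∀ᶠ N : ℕ in atTop,
      ∀ Ψ : TrialState N (sideLength ρ N),
        energy v Ψ ≤ groundStateEnergy v N (sideLength ρ N) + 1 →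
          ∫⁻ X, kineticDensity Ψ.ψ X ≤
            ENNReal.ofReal (4 * Real.pi * (scatteringLength v).toReal * ρ * (1 + μ) * N)

/-- **Window part of the crux — coherence defect INSIDE THE KINETIC WINDOW** (derived from S2, K, E by KB,
not itself a stub). For repulsive finite-range `v` with `a > 0`, every window constant `c₀ > 0`, every budget
cap `b > 16 c₀/√π` and every bracket base `ℓ_d > 0`: at small density a budget `β ≥ 0`, `Σ β ≤ b`, such that for
all large `N`, some `δ > 0` and every `δ`-near-minimiser, every level `m ≥ 1` in bracket `j` with cube side
`L/2^m ≤ c₀ (ρa)^{-1/2}` has `A_m ≤ A_{m-1} + β_j √N`. [cite: LSSY2005, Ch. 5 (5.15)–(5.17)] -/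
def DefectInKineticWindow : Prop :=
  ∀ v : ℝ → ℝ≥0∞, IsRepulsiveFiniteRange v → 0 < scatteringLength v →
    ∀ c₀ : ℝ, 0 < c₀ → ∀ b : ℝ, 16 * c₀ / Real.sqrt Real.pi < b → ∀ ℓd : ℝ, 0 < ℓd →
    ∃ ρ₀ : ℝ, 0 < ρ₀ ∧ ∀ ρ : ℝ, 0 < ρ → ρ < ρ₀ →
      ∃ β : ℕ → ℝ, (∀ j, 0 ≤ β j) ∧ Summable β ∧ ∑' j, β j ≤ b ∧ ∀ᶠ N : ℕ in atTop,
        let a : ℝ := (scatteringLength v).toReal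
        let L : ℝ := sideLength ρ N
        let φ : (m : ℕ) → (Fin 3 → Fin (2 ^ m)) → EuclideanSpace ℝ (Fin 3) → ℂ := fun m i =>
          Set.indicator {x : EuclideanSpace ℝ (Fin 3) | ∀ k : Fin 3, x k ∈
              Set.Ioo (((i k : ℕ) : ℝ) * (L / 2 ^ m)) ((((i k : ℕ) : ℝ) + 1) * (L / 2 ^ m))}
            (fun _ => ((Real.sqrt ((L / 2 ^ m) ^ 3))⁻¹ : ℂ))
        ∃ δ : ℝ≥0∞, 0 < δ ∧ ∀ Ψ : TrialState N L, energy v Ψ ≤ groundStateEnergy v N L + δ →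
          let A : ℕ → ℝ≥0∞ := fun m => (8 : ℝ≥0∞) ^ (-(m : ℝ) / 2) *
            ∑ i : Fin 3 → Fin (2 ^ m), (occupation N (φ m i) Ψ.ψ) ^ (1 / 2 : ℝ)
          ∀ m j : ℕ, 1 ≤ m → ℓd * 2 ^ j ≤ L / 2 ^ m → L / 2 ^ m < ℓd * 2 ^ (j + 1) →
            L / 2 ^ m ≤ c₀ * (ρ * a) ^ (-(1 : ℝ) / 2) →
            A m ≤ A (m - 1) + ENNReal.ofReal (β j) * (N : ℝ≥0∞) ^ (1 / 2 : ℝ)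

/-- **S1b statement — FREE-GAS COHERENCE DEFECT** (all levels; derived from the four free-gas stubs below by
`stub_freeAssembly`). For `v` with ZERO scattering length (`v = 0` a.e., LSSY App. C) the energy is the free
Dirichlet kinetic energy; its ground state `Ψ₀ = χ^{⊗N}`, `χ = ∏_k √(2/L) sin(πx_k/L)`, has POSITIVELY COLLINEAR
block Gram vectors, hence zero coherence defect at every level, and a `δ`-near-minimiser is `L²`-within
`√(δ/gap)` of `e^{iθ}Ψ₀` (gap `3π²/L²`), so its defect is `≤ 2√(Nδ/gap)` at every level: any positive summable
budget works (`β_j = 2^{-j}/16`) with `δ(N)` below `gap · β_{J(N)}²/4`. [cite: LSSY2005, §1.2 and Ch. 2 (2.50)] -/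
def FreeCoherenceDefect : Prop :=
  ∀ v : ℝ → ℝ≥0∞, IsRepulsiveFiniteRange v → scatteringLength v = 0 → ∀ ℓd : ℝ, 0 < ℓd →
    ∀ ρ : ℝ, 0 < ρ →
      ∃ β : ℕ → ℝ, (∀ j, 0 ≤ β j) ∧ Summable β ∧ ∑' j, β j ≤ 1 / 8 ∧ ∀ᶠ N : ℕ in atTop,
        let L : ℝ := sideLength ρ N
        let φ : (m : ℕ) → (Fin 3 → Fin (2 ^ m)) → EuclideanSpace ℝ (Fin 3) → ℂ := fun m i =>
          Set.indicator {x : EuclideanSpace ℝ (Fin 3) | ∀ k : Fin 3, x k ∈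
              Set.Ioo (((i k : ℕ) : ℝ) * (L / 2 ^ m)) ((((i k : ℕ) : ℝ) + 1) * (L / 2 ^ m))}
            (fun _ => ((Real.sqrt ((L / 2 ^ m) ^ 3))⁻¹ : ℂ))
        ∃ δ : ℝ≥0∞, 0 < δ ∧ ∀ Ψ : TrialState N L, energy v Ψ ≤ groundStateEnergy v N L + δ →
          let A : ℕ → ℝ≥0∞ := fun m => (8 : ℝ≥0∞) ^ (-(m : ℝ) / 2) *
            ∑ i : Fin 3 → Fin (2 ^ m), (occupation N (φ m i) Ψ.ψ) ^ (1 / 2 : ℝ)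
          ∀ m j : ℕ, 1 ≤ m → ℓd * 2 ^ j ≤ L / 2 ^ m → L / 2 ^ m < ℓd * 2 ^ (j + 1) →
            A m ≤ A (m - 1) + ENNReal.ofReal (β j) * (N : ℝ≥0∞) ^ (1 / 2 : ℝ)

/-- **Free-gas stub G — the FREE DIRICHLET GAP** (registered stub `stub_freeDirichletGap`, provable now, L):
for `N ≥ 1`, `L > 0` there is `c = c(N, L) > 0` (sharp: `3π²/L²`) with
`3Nπ²/L² + c ‖Ψ − ⟨Ψ₀, Ψ⟩Ψ₀‖² ≤ ∫ |∇Ψ|²` for every Dirichlet trial state `Ψ` (`energy 0`), where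
`Ψ₀(X) = 1_{Λ^N} ∏_i ∏_k √(2/L) sin(π X_{ik}/L)` is the normalised free ground state: sine-series Parseval on
`(0,L)^{3N}` for `Ψ` and `∇Ψ` (the 1-D identities `hasSum_sq_integral_sin_mul`, `integral_sin_mul_deriv` of
`NeumannCosineParseval.lean`, tensorised as in `NeumannBoxParseval.lean`), then
`Σ_k (λ_k − λ_𝟙)|ĉ_k|² ≥ 3π²/L² Σ_{k ≠ 𝟙} |ĉ_k|²`. [cite: LSSY2005, Ch. 2, after (2.50)] -/
def FreeDirichletGap : Prop :=
  ∀ (N : ℕ) (L : ℝ), 1 ≤ N → 0 < L → ∃ c : ℝ, 0 < c ∧ ∀ Ψ : TrialState N L,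
    let Ψ₀ : Config N → ℂ := fun X => (boxN N L).indicator
      (fun X => ∏ i : Fin N, ∏ k : Fin 3, ((Real.sqrt (2 / L) * Real.sin (Real.pi * X i k / L) : ℝ) : ℂ)) X
    ENNReal.ofReal (3 * N * Real.pi ^ 2 / L ^ 2) +
        ENNReal.ofReal c * ∫⁻ X, (‖Ψ.ψ X - (∫ Y, (starRingEnd ℂ) (Ψ₀ Y) * Ψ.ψ Y) * Ψ₀ X‖₊ : ℝ≥0∞) ^ 2 ≤
      energy 0 Ψ

/-- **Free-gas stub U — FREE DIRICHLET GROUND-STATE ENERGY FROM ABOVE** (registered stub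
`stub_freeDirichletEnergy`, provable now, M/L): `E₀(v = 0, N, L) ≤ 3Nπ²/L²` — `C¹` Dirichlet approximants of
`∏ sin(πx/L)` (cut off near the faces) have kinetic energy `→ 3Nπ²/L²`; products of one-particle states are
Bose-symmetric trial states (`BoseGasProductState.lean`). [cite: LSSY2005, Ch. 2 (2.3)] -/
def FreeDirichletEnergy : Prop :=
  ∀ (N : ℕ) (L : ℝ), 1 ≤ N → 0 < L →
    groundStateEnergy 0 N L ≤ ENNReal.ofReal (3 * N * Real.pi ^ 2 / L ^ 2)

/-- **Free-gas stub D1 — ZERO SCATTERING LENGTH MEANS NO INTERACTION** (registered stub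
`stub_zeroScatteringEnergy`, provable now, M): `a(v) = 0` forces `v(|x|) = 0` for a.e. `x ∈ ℝ³`
(`LSSY2005_zeroScatteringLength_holds`), the pair-distance level sets of a null set are null in `(ℝ³)^N`
(Fubini + translation invariance), so `interaction v = 0` a.e. and `energy v Ψ = energy 0 Ψ`.
[cite: LSSY2005, App. C, Thm. C.1 (C.8)] -/
def ZeroScatteringEnergy : Prop :=
  ∀ v : ℝ → ℝ≥0∞, IsRepulsiveFiniteRange v → scatteringLength v = 0 →
    ∀ (N : ℕ) (L : ℝ) (Ψ : TrialState N L), energy v Ψ = energy 0 Ψ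

/-- **Free-gas stub DP — PERTURBATION OF THE COHERENCE DEFECT AROUND THE FREE GROUND STATE** (registered stub
`stub_defectPerturbation`, provable now, M/L): for every Dirichlet trial state `Ψ`, every `α ∈ ℂ` and every
level `m ≥ 1`, `A_m(Ψ) ≤ A_{m-1}(Ψ) + 2 √(N ∫|Ψ − αΨ₀|²)`: the Gram vectors are linear in `Ψ`
(`u_C(Ψ) = α u_C(Ψ₀) + u_C(W)`, slices integrable), those of `Ψ₀` are non-negative multiples
`κ_C g` of ONE function (`κ_C = (L/2^m)^{-3/2} ∫_C χ ≥ 0`), so `Σ_C ‖u_C(αΨ₀)‖ = ‖Σ_C u_C(αΨ₀)‖` per parent,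
the triangle inequality in `L²(dY)` leaves `2 Σ_C ‖u_C(W)‖`, and Bessel (`cohSum_le_mul_lintegral`) gives
`Σ_{C ∈ level m} ‖u_C(W)‖ ≤ 8^{m/2} ‖W‖₂`. [cite: LSSY2005, §1.2 (1.17)] -/
def DefectPerturbation : Prop :=
  ∀ (N : ℕ) (L : ℝ), 0 < L → ∀ (Ψ : TrialState N L) (α : ℂ) (m : ℕ), 1 ≤ m →
    let Ψ₀ : Config N → ℂ := fun X => (boxN N L).indicator
      (fun X => ∏ i : Fin N, ∏ k : Fin 3, ((Real.sqrt (2 / L) * Real.sin (Real.pi * X i k / L) : ℝ) : ℂ)) X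
    let φ : (m : ℕ) → (Fin 3 → Fin (2 ^ m)) → EuclideanSpace ℝ (Fin 3) → ℂ := fun m i =>
      Set.indicator {x : EuclideanSpace ℝ (Fin 3) | ∀ k : Fin 3, x k ∈
          Set.Ioo (((i k : ℕ) : ℝ) * (L / 2 ^ m)) ((((i k : ℕ) : ℝ) + 1) * (L / 2 ^ m))}
        (fun _ => ((Real.sqrt ((L / 2 ^ m) ^ 3))⁻¹ : ℂ))
    let A : ℕ → ℝ≥0∞ := fun m => (8 : ℝ≥0∞) ^ (-(m : ℝ) / 2) *
      ∑ i : Fin 3 → Fin (2 ^ m), (occupation N (φ m i) Ψ.ψ) ^ (1 / 2 : ℝ)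
    A m ≤ A (m - 1) + 2 * ((N : ℝ≥0∞) * ∫⁻ X, (‖Ψ.ψ X - α * Ψ₀ X‖₊ : ℝ≥0∞) ^ 2) ^ (1 / 2 : ℝ)

/-- **Free-gas stub D — ASSEMBLY** (registered stub `stub_freeAssembly`, provable now, M/L):
`FreeDirichletGap → FreeDirichletEnergy → ZeroScatteringEnergy → DefectPerturbation → FreeCoherenceDefect`
(budget `β_j = 2^{-j}/16`; for `N ≥ 1` only brackets `j ≤ ⌈L/ℓ_d⌉₊` occur; `δ := ofReal (c β_J² / 4)`;
`energy v = energy 0`, `E₀(v) = E₀(0) ≤ 3Nπ²/L²`, so `c‖W‖² ≤ δ` and DP closes each level). [folklore] -/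
def FreeAssembly : Prop :=
  FreeDirichletGap → FreeDirichletEnergy → ZeroScatteringEnergy → DefectPerturbation → FreeCoherenceDefect
/-- **S2 statement — the level-occupation ladder and the increment bound.** For every `N`, `L`, every
Dirichlet trial state `Ψ` and every level `m ≥ 1`, with `T_m = Σ_{C ∈ level m} ⟨φ_C, γ_Ψ φ_C⟩` (open
dyadic cubes of side `L/2^m`, flat modes) and `A_m = 8^{-m/2} Σ_C √⟨φ_C, γ_Ψ φ_C⟩`:
`T_{m-1} ≤ T_m ≤ N` and `A_m ≤ A_{m-1} + √(T_m − T_{m-1})` (truncated subtraction in `ℝ≥0∞`). The first two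
are `cohSum_le_cohSum_succ` / `cohSum_le_card` transported along `openCell_ae_eq_dyCell`; the third is
`Σ_C‖u_C‖ − ‖Σ_C u_C‖ ≤ √(8(Σ_C‖u_C‖² − 8‖u_P‖²/1))` per parent (`√x − √y ≤ √(x−y)`, Cauchy–Schwarz) and
Cauchy–Schwarz over the `8^{m-1}` parents. [cite: LSSY2005, §1.2 (1.17)] -/
def LevelIncrement : Prop :=
  ∀ (N : ℕ) (L : ℝ) (Ψ : TrialState N L) (m : ℕ), 1 ≤ m →
    let φ : (m : ℕ) → (Fin 3 → Fin (2 ^ m)) → EuclideanSpace ℝ (Fin 3) → ℂ := fun m i =>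
      Set.indicator {x : EuclideanSpace ℝ (Fin 3) | ∀ k : Fin 3, x k ∈
          Set.Ioo (((i k : ℕ) : ℝ) * (L / 2 ^ m)) ((((i k : ℕ) : ℝ) + 1) * (L / 2 ^ m))}
        (fun _ => ((Real.sqrt ((L / 2 ^ m) ^ 3))⁻¹ : ℂ))
    let T : ℕ → ℝ≥0∞ := fun m => ∑ i : Fin 3 → Fin (2 ^ m), occupation N (φ m i) Ψ.ψ
    let A : ℕ → ℝ≥0∞ := fun m => (8 : ℝ≥0∞) ^ (-(m : ℝ) / 2) *
      ∑ i : Fin 3 → Fin (2 ^ m), (occupation N (φ m i) Ψ.ψ) ^ (1 / 2 : ℝ)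
    T (m - 1) ≤ T m ∧ T m ≤ N ∧ A m ≤ A (m - 1) + (T m - T (m - 1)) ^ (1 / 2 : ℝ)

/-- **KB statement — the KINETIC WINDOW BUDGET** (stub `stub_kineticWindowBudget`, LANDED p152920): the level ladder
(S2), the block kinetic bound (K) and the kinetic budget (E) give the window part of the crux: per window
level `defect_m ≤ √(T_m − T_{m-1}) ≤ √(N − T_{m-1}) ≤ (2s/π) √(4πaρ(1+μ)N) = 4 s √(aρ(1+μ)/π) √N`
(`s = L/2^m < ℓ_d 2^{j+1}`), so `β_j = 8 ℓ_d 2^j √(aρ(1+μ)/π)` on the finitely many brackets with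
`ℓ_d 2^j ≤ c₀(ρa)^{-1/2}` (zero above) works, and `Σ_j β_j ≤ 16 c₀ √((1+μ)/π) ≤ b` for `μ` small.
[cite: LSSY2005, Ch. 5 (5.15)–(5.17)] -/
def KineticWindowBudget : Prop :=
  LevelIncrement → BlockKineticBound → KineticBudget → DefectInKineticWindow


/-- **P statement — POWER-LAW HAAR BAND** (a cleaner SUFFICIENT form of S1″ offered to an engine / to the
planners; glue stub `stub_powerLawSuffices : P → S1″` LANDED p154043). For `v` with `a > 0` there are a window constant
`c₀ ∈ (0, 1/50]` and an exponent `α > 0` such that for EVERY `ε > 0`, at small density, for all large `N`, some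
`δ > 0` and every `δ`-near-minimiser: every level `m ≥ 1` with `s_* := c₀(ρa)^{-1/2} < s = L/2^m` has
`T_m − T_{m-1} ≤ ε (s_*/s)^α N`. Bogoliubov bulk phonons give `(ξ/s)² ln(s/ξ)/(ρξ³)`; the Dirichlet WALL LAYER adds
`≈ 12 ξ_w²/(sL)` (`ξ_w ∼ ξ` its thickness; level 1 carries none by symmetry), which decays only like `1/s` at fixed
`L`: at level 2 (`s = L/4`) the ratio band/`(N (s_*/s)²)` is `≈ 3ξ_w²/s_*²`, independent of `L` — so the pure-phonon
exponent `α = 2` is FALSE in the Dirichlet box, while every `α < 2` absorbs the wall term under `∀ᶠ N` (it is then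
`≲ ξ_w² L^{α-2} s_*^{-α} → 0`); expect `α ∈ (0, 2)`. [cite: arXiv:2603.20776, Rem. 7; LSSY2005, §1.2 (1.17)] -/
def PowerLawHaarBand : Prop :=
  ∀ v : ℝ → ℝ≥0∞, IsRepulsiveFiniteRange v → 0 < scatteringLength v →
    ∃ c₀ α : ℝ, 0 < c₀ ∧ c₀ ≤ 1 / 50 ∧ 0 < α ∧ ∀ ε : ℝ, 0 < ε →
    ∃ ρ₀ : ℝ, 0 < ρ₀ ∧ ∀ ρ : ℝ, 0 < ρ → ρ < ρ₀ → ∀ᶠ N : ℕ in atTop,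
      let a : ℝ := (scatteringLength v).toReal
      let L : ℝ := sideLength ρ N
      let φ : (m : ℕ) → (Fin 3 → Fin (2 ^ m)) → EuclideanSpace ℝ (Fin 3) → ℂ := fun m i =>
        Set.indicator {x : EuclideanSpace ℝ (Fin 3) | ∀ k : Fin 3, x k ∈
            Set.Ioo (((i k : ℕ) : ℝ) * (L / 2 ^ m)) ((((i k : ℕ) : ℝ) + 1) * (L / 2 ^ m))}
          (fun _ => ((Real.sqrt ((L / 2 ^ m) ^ 3))⁻¹ : ℂ))
      ∃ δ : ℝ≥0∞, 0 < δ ∧ ∀ Ψ : TrialState N L, energy v Ψ ≤ groundStateEnergy v N L + δ →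
        let T : ℕ → ℝ≥0∞ := fun m => ∑ i : Fin 3 → Fin (2 ^ m), occupation N (φ m i) Ψ.ψ
        ∀ m : ℕ, 1 ≤ m → c₀ * (ρ * a) ^ (-(1 : ℝ) / 2) < L / 2 ^ m →
          T m - T (m - 1) ≤
            ENNReal.ofReal (ε * (c₀ * (ρ * a) ^ (-(1 : ℝ) / 2) / (L / 2 ^ m)) ^ α * N)

/-- **PS statement — the power law suffices**: `PowerLawHaarBand → HaarBandAboveKineticWindow` (glue stub
`stub_powerLawSuffices`, LANDED p154043: `ℓ_d = 1`, `b = 1/40`, `β_j = √ε (s_*/2^j)^{α/2}` on the brackets with `s_* < 2^{j+1}`,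
a geometric series of ratio `2^{-α/2}` with sum `< √ε 2^{α/2}/(1 − 2^{-α/2}) ≤ b` for `ε` small). [folklore] -/
def PowerLawSuffices : Prop :=
  PowerLawHaarBand → HaarBandAboveKineticWindow


-- END DEFS

/-! ## Audit aliases: the composition's hypotheses are the declared stubs BY NAME

The skeleton audit admits a hypothesis whose head constant's last name component is a declared stub name;
the aliases live in the implementation-detail namespace `__Goal` so that the audit's stub table resolves each
`stub_*` to the sorried THEOREM below (its signature), never to the alias. -/

namespace __Goal

/-- Audit alias of stub S1″ (`stub_haarBandAboveKineticWindow`): the statement `HaarBandAboveKineticWindow`.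
[folklore] -/
abbrev stub_haarBandAboveKineticWindow : Prop := HaarBandAboveKineticWindow

/-- Audit alias of stub K (`stub_blockKineticBound`, LANDED p151816): the statement `BlockKineticBound`.
[folklore] -/
abbrev stub_blockKineticBound : Prop := BlockKineticBound

/-- Audit alias of stub E (`stub_kineticBudget`, LANDED p152151): the statement `KineticBudget`. [folklore] -/
abbrev stub_kineticBudget : Prop := KineticBudget

/-- Audit alias of stub KB (`stub_kineticWindowBudget`, LANDED p152920): the statement `KineticWindowBudget`. [folklore] -/
abbrev stub_kineticWindowBudget : Prop := KineticWindowBudget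

/-- Audit alias of stub PS (`stub_powerLawSuffices`, LANDED p154043): the statement `PowerLawSuffices`. [folklore] -/
abbrev stub_powerLawSuffices : Prop := PowerLawSuffices

/-- Audit alias of stub D (`stub_freeAssembly`, LANDED p145661): the statement `FreeAssembly`. [folklore] -/
abbrev stub_freeAssembly : Prop := FreeAssembly

/-- Audit alias of stub S2 (`stub_levelIncrement`, LANDED p144089): the statement `LevelIncrement`. [folklore] -/
abbrev stub_levelIncrement : Prop := LevelIncrement

end __Goal

/-! ## Registered stubs (the ONLY `sorry`s of this file) -/

/-- **Stub S1″ (XL/open, HARDEST): Haar-band occupation above the kinetic window** — see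
`HaarBandAboveKineticWindow`. [cite: arXiv:2603.20776, Rem. 7] -/
theorem stub_haarBandAboveKineticWindow :
    ∀ v : ℝ → ℝ≥0∞, IsRepulsiveFiniteRange v → 0 < scatteringLength v →
      ∃ c₀ b ℓd : ℝ, 0 < c₀ ∧ 0 ≤ b ∧ 10 * c₀ + b < 1 / 4 ∧ 0 < ℓd ∧
      ∃ ρ₀ : ℝ, 0 < ρ₀ ∧ ∀ ρ : ℝ, 0 < ρ → ρ < ρ₀ →
        ∃ β : ℕ → ℝ, (∀ j, 0 ≤ β j) ∧ Summable β ∧ ∑' j, β j ≤ b ∧ ∀ᶠ N : ℕ in atTop,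
          let a : ℝ := (scatteringLength v).toReal
          let L : ℝ := sideLength ρ N
          let φ : (m : ℕ) → (Fin 3 → Fin (2 ^ m)) → EuclideanSpace ℝ (Fin 3) → ℂ := fun m i =>
            Set.indicator {x : EuclideanSpace ℝ (Fin 3) | ∀ k : Fin 3, x k ∈
                Set.Ioo (((i k : ℕ) : ℝ) * (L / 2 ^ m)) ((((i k : ℕ) : ℝ) + 1) * (L / 2 ^ m))}
              (fun _ => ((Real.sqrt ((L / 2 ^ m) ^ 3))⁻¹ : ℂ))
          ∃ δ : ℝ≥0∞, 0 < δ ∧ ∀ Ψ : TrialState N L, energy v Ψ ≤ groundStateEnergy v N L + δ →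
            let T : ℕ → ℝ≥0∞ := fun m => ∑ i : Fin 3 → Fin (2 ^ m), occupation N (φ m i) Ψ.ψ
            ∀ m j : ℕ, 1 ≤ m → ℓd * 2 ^ j ≤ L / 2 ^ m → L / 2 ^ m < ℓd * 2 ^ (j + 1) →
              c₀ * (ρ * a) ^ (-(1 : ℝ) / 2) < L / 2 ^ m →
              (T m - T (m - 1)) ^ (1 / 2 : ℝ) ≤ ENNReal.ofReal (β j) * (N : ℝ≥0∞) ^ (1 / 2 : ℝ) := by
  sorry

/-! **Stubs LANDED** (imported above, same namespace, registered signatures; the sorried copies are deleted here):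
lead c1 — `stub_levelIncrement` (p144089), `stub_zeroScatteringEnergy` (p145542), `stub_defectPerturbation` (p145905),
`stub_freeAssembly` (p145661), `stub_freeDirichletGap` (p147597), `stub_freeDirichletEnergy` (p148928);
lead c2 — K `stub_blockKineticBound` (p151816), E `stub_kineticBudget` (p152151, wave 3),
KB `stub_kineticWindowBudget` (p152920, wave 3), PS `stub_powerLawSuffices` (p154043, wave 4). -/

/-! ## Glue (sorry-free) -/

/-- **S1b from the free-gas stubs** (the assembly applied to G, U, D1, DP; all landed, by name). [folklore] -/
theorem freeCoherenceDefect_of_stubs : FreeCoherenceDefect :=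
  stub_freeAssembly stub_freeDirichletGap stub_freeDirichletEnergy stub_zeroScatteringEnergy
    stub_defectPerturbation

/-- `16/√π < 10` (`π > 2.56`): the kinetic window's budget `16 c₀/√π` fits under S1″'s slack `10 c₀`.
[folklore] -/
theorem sixteen_div_sqrt_pi_lt_ten : 16 / Real.sqrt Real.pi < 10 := by
  have h16 : (8 / 5 : ℝ) < Real.sqrt Real.pi := by
    refine (Real.lt_sqrt (by norm_num)).2 ?_
    nlinarith [Real.pi_gt_three]
  rw [div_lt_iff₀ (Real.sqrt_pos.2 Real.pi_pos)]
  linarith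

/-- **The window part is a THEOREM**: `DefectInKineticWindow` from the landed KB applied to the landed S2, K, E.
[folklore] -/
theorem defectInKineticWindow_holds : DefectInKineticWindow :=
  stub_kineticWindowBudget stub_levelIncrement stub_blockKineticBound stub_kineticBudget


/-- **S1″ from the power law** (the landed glue stub PS). [folklore] -/
theorem haarBandAboveKineticWindow_of_powerLaw : PowerLawHaarBand → HaarBandAboveKineticWindow :=
  stub_powerLawSuffices

/-! ## Composition (sorry-free): the registered stubs give the crux BY NAME -/

/-- **`DyadicCoherenceDefect` from the ONE open stub of the reshaped line.** Hypothesis = the open stub S1″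
BY NAME (through the `__Goal` alias); the landed stubs (S2, the free-gas half, K, E, KB) are used as theorems;
conclusion = the route decl `BECDyadicChaining.DyadicCoherenceDefect`.
Glue: split on `a = 0` (free gas: `ℓ_d = 1`, every `ρ`, budget `≤ 1/8`) / `a > 0`: `c₀, b, ℓ_d` from S1″,
the window part at `(c₀, 1/4 − b, ℓ_d)` (admissible since `16 c₀/√π < 10 c₀ < 1/4 − b`), `ρ₀ = min`,
`β = β¹ + β²`, eventualities intersected, `δ = min`, and per level the case split
`c₀(ρa)^{-1/2} < L/2^m` (S1″, T-form → defect by S2) / `L/2^m ≤ c₀(ρa)^{-1/2}` (window) — all of it LANDED as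
`dyadicCoherenceDefect_of_haarBandAboveKineticWindow` (p156875, lead c3); here it is one application. [folklore] -/
theorem DyadicCoherenceDefect_of_stubs :
    __Goal.stub_haarBandAboveKineticWindow → BECDyadicChaining.DyadicCoherenceDefect :=
  fun hH => dyadicCoherenceDefect_of_haarBandAboveKineticWindow hH


/-- **`DyadicCoherenceDefect` from the power-law Haar band** (P, via the landed glue PS and the composition):
sorry-free. [folklore] -/
theorem DyadicCoherenceDefect_of_powerLaw : PowerLawHaarBand → BECDyadicChaining.DyadicCoherenceDefect :=
  fun hP => DyadicCoherenceDefect_of_stubs (stub_powerLawSuffices hP)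

/-! ## Honesty check (lead c2): S1″ alone ⇒ the route's target X_B1 (zero-mode occupation ≥ N/2)

`HaarBandAboveKineticWindow ⇒ ZeroModeOccupation-form (c = 1/2)` for every admissible `v` with positive
scattering length, using only the kinetic window (K, E landed): the Haar-band budget telescopes
(`T_{m₀-1} − n₀ ≤ N(Σβ)² ≤ N/16`, `m₀` the first level with `L/2^{m₀} ≤ s = c₀(ρa)^{-1/2}`) and the block
kinetic bound at level `m₀ − 1` gives `T_{m₀-1} ≥ N − (2s/π)²·8πaρN = (1 − 32c₀²/π)N ≥ 3N/4`; `T_0 = n₀`.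
So the open stub S1″ is at least as strong as the route's target: the line is a scale-by-scale
REFORMULATION of zero-mode condensation above `≈ 0.1ξ`, not a reduction of it. -/

/-- Telescoping in `ℝ≥0∞` with truncated subtraction: `T k ≤ T 0 + Σ_{m=1}^{k} (T m − T (m−1))`. [folklore] -/
theorem le_add_sum_tsub (T : ℕ → ℝ≥0∞) (k : ℕ) :
    T k ≤ T 0 + ∑ m ∈ Finset.Icc 1 k, (T m - T (m - 1)) := by
  induction k with
  | zero => simp
  | succ k ih =>
    calc T (k + 1) ≤ T k + (T (k + 1) - T k) := le_add_tsub
      _ ≤ (T 0 + ∑ m ∈ Finset.Icc 1 k, (T m - T (m - 1))) + (T (k + 1) - T k) := add_le_add ih le_rfl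
      _ = T 0 + ∑ m ∈ Finset.Icc 1 (k + 1), (T m - T (m - 1)) := by
        rw [Finset.sum_Icc_succ_top (Nat.succ_le_succ (Nat.zero_le k)), Nat.add_sub_cancel, add_assoc]

/-- `Σ xᵢ² ≤ (Σ xᵢ)²` for non-negative reals. [folklore] -/
theorem sum_sq_le_sq_sum {ι : Type*} (s : Finset ι) {x : ι → ℝ} (hx : ∀ i ∈ s, 0 ≤ x i) :
    ∑ i ∈ s, x i ^ 2 ≤ (∑ i ∈ s, x i) ^ 2 := by
  rw [sq, Finset.sum_mul]
  refine Finset.sum_le_sum fun i hi => ?_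
  rw [sq]
  exact mul_le_mul_of_nonneg_left (Finset.single_le_sum hx hi) (hx i hi)

/-- `x^{1/2} ≤ y ⇒ x ≤ y²` in `ℝ≥0∞`. [folklore] -/
theorem le_sq_of_rpow_half_le {x y : ℝ≥0∞} (h : x ^ (1 / 2 : ℝ) ≤ y) : x ≤ y ^ 2 := by
  have h2 : (x ^ (1 / 2 : ℝ)) ^ 2 ≤ y ^ 2 := pow_le_pow_left' h 2
  rwa [← ENNReal.rpow_natCast (x ^ (1 / 2 : ℝ)) 2, ← ENNReal.rpow_mul,
    show (1 / 2 : ℝ) * ((2 : ℕ) : ℝ) = 1 by norm_num, ENNReal.rpow_one] at h2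

/-- **Core of the honesty check (one box, one state; bracket base `ℓ_d`, budget `≤ 1/4`).** If the
Haar-band increments above the scale `s` (`ℓ_d ≤ s < L`) are budgeted by `β` (`Σβ ≤ 1/4`) and the level just
above the first level of side `≤ s` carries `≥ 3N/4`, then the box's flat mode carries `≥ N/2`
(`3/4 − (1/4)² = 11/16 ≥ 1/2`). [folklore] -/
theorem zeroMode_core' {N : ℕ} {L ℓd s : ℝ} (Ψ : TrialState N L) (hℓd : 0 < ℓd) (hℓs : ℓd ≤ s)
    (hs0 : 0 < s) (hsL : s < L)
    {β : ℕ → ℝ} (hβ0 : ∀ j, 0 ≤ β j) (hβs : Summable β) (hβt : ∑' j, β j ≤ 1 / 4)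
    (hHaar : ∀ m j : ℕ, 1 ≤ m → ℓd * 2 ^ j ≤ L / 2 ^ m → L / 2 ^ m < ℓd * 2 ^ (j + 1) → s < L / 2 ^ m →
      (∑ i : Fin 3 → Fin (2 ^ m), occupation N (Set.indicator {x : EuclideanSpace ℝ (Fin 3) | ∀ k : Fin 3,
          x k ∈ Set.Ioo (((i k : ℕ) : ℝ) * (L / 2 ^ m)) ((((i k : ℕ) : ℝ) + 1) * (L / 2 ^ m))}
          (fun _ => ((Real.sqrt ((L / 2 ^ m) ^ 3))⁻¹ : ℂ))) Ψ.ψ -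
        ∑ i : Fin 3 → Fin (2 ^ (m - 1)), occupation N (Set.indicator {x : EuclideanSpace ℝ (Fin 3) | ∀ k : Fin 3,
          x k ∈ Set.Ioo (((i k : ℕ) : ℝ) * (L / 2 ^ (m - 1))) ((((i k : ℕ) : ℝ) + 1) * (L / 2 ^ (m - 1)))}
          (fun _ => ((Real.sqrt ((L / 2 ^ (m - 1)) ^ 3))⁻¹ : ℂ))) Ψ.ψ) ^ (1 / 2 : ℝ) ≤
        ENNReal.ofReal (β j) * (N : ℝ≥0∞) ^ (1 / 2 : ℝ))
    (hWL : ∀ m₀ : ℕ, 1 ≤ m₀ → L / 2 ^ m₀ ≤ s → ENNReal.ofReal (3 / 4 * N) ≤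
      ∑ i : Fin 3 → Fin (2 ^ (m₀ - 1)), occupation N (Set.indicator {x : EuclideanSpace ℝ (Fin 3) | ∀ k : Fin 3,
          x k ∈ Set.Ioo (((i k : ℕ) : ℝ) * (L / 2 ^ (m₀ - 1))) ((((i k : ℕ) : ℝ) + 1) * (L / 2 ^ (m₀ - 1)))}
          (fun _ => ((Real.sqrt ((L / 2 ^ (m₀ - 1)) ^ 3))⁻¹ : ℂ))) Ψ.ψ) :
    ENNReal.ofReal (1 / 2 * N) ≤ occupation N ((box L).indicator fun _ => ((Real.sqrt (L ^ 3))⁻¹ : ℂ)) Ψ.ψ := by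
  have hLpos : 0 < L := hs0.trans hsL
  -- block modes and level occupations
  set φf : (m : ℕ) → (Fin 3 → Fin (2 ^ m)) → EuclideanSpace ℝ (Fin 3) → ℂ := fun m i =>
    Set.indicator {x : EuclideanSpace ℝ (Fin 3) | ∀ k : Fin 3, x k ∈ Set.Ioo (((i k : ℕ) : ℝ) * (L / 2 ^ m))
      ((((i k : ℕ) : ℝ) + 1) * (L / 2 ^ m))} (fun _ => ((Real.sqrt ((L / 2 ^ m) ^ 3))⁻¹ : ℂ)) with hφf
  set T : ℕ → ℝ≥0∞ := fun m => ∑ i : Fin 3 → Fin (2 ^ m), occupation N (φf m i) Ψ.ψ with hT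
  -- the first level `m₀` of side `≤ s`
  have hex : ∃ m : ℕ, L / 2 ^ m ≤ s := by
    obtain ⟨m, hm⟩ := pow_unbounded_of_one_lt (L / s) one_lt_two
    refine ⟨m, ?_⟩
    rw [div_le_iff₀ (pow_pos two_pos m)]
    rw [div_lt_iff₀ hs0] at hm
    linarith [mul_comm s ((2 : ℝ) ^ m)]
  classical
  set m₀ : ℕ := Nat.find hex with hm₀
  have hm₀s : L / 2 ^ m₀ ≤ s := Nat.find_spec hex
  have hm₀min : ∀ m, m < m₀ → s < L / 2 ^ m := fun m hm => lt_of_not_ge (Nat.find_min hex hm)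
  have hm₀pos : 1 ≤ m₀ := by
    by_contra h0
    have h00 : m₀ = 0 := by omega
    have h := hm₀s
    rw [h00, pow_zero, div_one] at h
    linarith
  -- mass at the level `m₀ - 1`
  have hT34 : ENNReal.ofReal (3 / 4 * N) ≤ T (m₀ - 1) := hWL m₀ hm₀pos hm₀s
  -- the brackets of the levels above `s` (all have side `≥ ℓ_d`)
  have hbr : ∀ m, m < m₀ → ∃ j : ℕ, ℓd * 2 ^ j ≤ L / 2 ^ m ∧ L / 2 ^ m < ℓd * 2 ^ (j + 1) := by
    intro m hm
    have hx : 1 ≤ L / 2 ^ m / ℓd := by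
      rw [le_div_iff₀ hℓd, one_mul]; exact hℓs.trans (hm₀min m hm).le
    obtain ⟨j, hj1, hj2⟩ := exists_nat_pow_near hx one_lt_two
    refine ⟨j, ?_, ?_⟩
    · have := (le_div_iff₀ hℓd).mp hj1
      linarith [mul_comm ((2 : ℝ) ^ j) ℓd]
    · have := (div_lt_iff₀ hℓd).mp hj2
      linarith [mul_comm ((2 : ℝ) ^ (j + 1)) ℓd]
  choose! jf hjf1 hjf2 using hbr
  have hup : ∀ m, m < m₀ → (2 : ℝ) ^ (jf m + m) ≤ L / ℓd := by
    intro m hm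
    rw [le_div_iff₀ hℓd]
    have := (le_div_iff₀ (pow_pos two_pos m)).mp (hjf1 m hm)
    calc (2 : ℝ) ^ (jf m + m) * ℓd = ℓd * 2 ^ jf m * 2 ^ m := by rw [pow_add]; ring
      _ ≤ L := this
  have hlow : ∀ m, m < m₀ → L / ℓd < (2 : ℝ) ^ (jf m + m + 1) := by
    intro m hm
    rw [div_lt_iff₀ hℓd]
    have := (div_lt_iff₀ (pow_pos two_pos m)).mp (hjf2 m hm)
    calc L < ℓd * 2 ^ (jf m + 1) * 2 ^ m := this
      _ = (2 : ℝ) ^ (jf m + m + 1) * ℓd := by rw [pow_add, pow_add, pow_add]; ring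
  have hle : ∀ m m', m < m₀ → m' < m₀ → jf m + m ≤ jf m' + m' := by
    intro m m' hm hm'
    by_contra hcon
    have hcon' : jf m' + m' + 1 ≤ jf m + m := by omega
    have h3 : (2 : ℝ) ^ (jf m' + m' + 1) ≤ 2 ^ (jf m + m) := pow_le_pow_right₀ one_le_two hcon'
    exact absurd ((hup m hm).trans_lt (hlow m' hm')) (not_lt.mpr h3)
  have hinj : ∀ m ∈ Finset.Icc 1 (m₀ - 1), ∀ m' ∈ Finset.Icc 1 (m₀ - 1), jf m = jf m' → m = m' := by
    intro m hm m' hm' hjj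
    rw [Finset.mem_Icc] at hm hm'
    have e1 := hle m m' (by omega) (by omega)
    have e2 := hle m' m (by omega) (by omega)
    omega
  -- each level above `s` costs at most `β_j² N`
  have hstep : ∀ m ∈ Finset.Icc 1 (m₀ - 1), T m - T (m - 1) ≤ ENNReal.ofReal (β (jf m) ^ 2) * (N : ℝ≥0∞) := by
    intro m hm
    rw [Finset.mem_Icc] at hm
    have hmlt : m < m₀ := by omega
    have h := hHaar m (jf m) hm.1 (hjf1 m hmlt) (hjf2 m hmlt) (hm₀min m hmlt)
    have h2 := le_sq_of_rpow_half_le h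
    rwa [mul_pow, ← ENNReal.ofReal_pow (hβ0 _), ← ENNReal.rpow_natCast ((N : ℝ≥0∞) ^ (1 / 2 : ℝ)) 2,
      ← ENNReal.rpow_mul, show (1 / 2 : ℝ) * ((2 : ℕ) : ℝ) = 1 by norm_num, ENNReal.rpow_one] at h2
  -- the summed budget is at most `N/16`
  have hbudget : ∑ m ∈ Finset.Icc 1 (m₀ - 1), ENNReal.ofReal (β (jf m) ^ 2) * (N : ℝ≥0∞) ≤
      ENNReal.ofReal (1 / 16) * (N : ℝ≥0∞) := by
    rw [← Finset.sum_mul]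
    refine mul_le_mul' ?_ le_rfl
    rw [← ENNReal.ofReal_sum_of_nonneg (fun m _ => sq_nonneg _)]
    refine ENNReal.ofReal_le_ofReal ?_
    have hsum_eq : ∑ j ∈ (Finset.Icc 1 (m₀ - 1)).image jf, β j ^ 2 =
        ∑ m ∈ Finset.Icc 1 (m₀ - 1), β (jf m) ^ 2 := Finset.sum_image hinj
    calc ∑ m ∈ Finset.Icc 1 (m₀ - 1), β (jf m) ^ 2
        = ∑ j ∈ (Finset.Icc 1 (m₀ - 1)).image jf, β j ^ 2 := hsum_eq.symm
      _ ≤ (∑ j ∈ (Finset.Icc 1 (m₀ - 1)).image jf, β j) ^ 2 := sum_sq_le_sq_sum _ (fun j _ => hβ0 j)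
      _ ≤ (∑' j, β j) ^ 2 := by
          gcongr
          · exact Finset.sum_nonneg fun j _ => hβ0 j
          · exact hβs.sum_le_tsum _ (fun j _ => hβ0 j)
      _ ≤ (1 / 4) ^ 2 := by
          gcongr
          exact tsum_nonneg hβ0
      _ = 1 / 16 := by norm_num
  -- telescoping: `T (m₀-1) ≤ T 0 + N/16`
  have htele : T (m₀ - 1) ≤ T 0 + ENNReal.ofReal (1 / 16) * (N : ℝ≥0∞) :=
    (le_add_sum_tsub T (m₀ - 1)).trans (add_le_add le_rfl ((Finset.sum_le_sum hstep).trans hbudget))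
  -- `T 0` is the occupation of the box's flat mode
  obtain ⟨i₀, hi₀⟩ : ∃ i₀ : Fin 3 → Fin (2 ^ 0), ∀ k, ((i₀ k : ℕ) : ℝ) = 0 :=
    ⟨fun _ => ⟨0, by norm_num⟩, fun _ => by simp⟩
  have hsub : Subsingleton (Fin 3 → Fin (2 ^ 0)) := by rw [pow_zero]; infer_instance
  have hT0 : T 0 = occupation N ((box L).indicator (fun _ => ((Real.sqrt (L ^ 3))⁻¹ : ℂ))) Ψ.ψ := by
    have e1 : T 0 = ∑ i : Fin 3 → Fin (2 ^ 0), occupation N (φf 0 i) Ψ.ψ := rfl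
    rw [e1, Fintype.sum_subsingleton _ i₀]
    have hset : {x : EuclideanSpace ℝ (Fin 3) | ∀ k : Fin 3, x k ∈ Set.Ioo (((i₀ k : ℕ) : ℝ) * (L / 2 ^ 0))
        ((((i₀ k : ℕ) : ℝ) + 1) * (L / 2 ^ 0))} = box L := by
      ext x; simp [box]
    have hnorm : ((Real.sqrt ((L / 2 ^ 0) ^ 3))⁻¹ : ℂ) = ((Real.sqrt (L ^ 3))⁻¹ : ℂ) := by
      rw [pow_zero, div_one]
    show occupation N (Set.indicator {x : EuclideanSpace ℝ (Fin 3) | ∀ k : Fin 3, x k ∈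
      Set.Ioo (((i₀ k : ℕ) : ℝ) * (L / 2 ^ 0)) ((((i₀ k : ℕ) : ℝ) + 1) * (L / 2 ^ 0))}
        (fun _ => ((Real.sqrt ((L / 2 ^ 0) ^ 3))⁻¹ : ℂ))) Ψ.ψ = _
    rw [hset, hnorm]
  -- conclusion
  have hfin : ENNReal.ofReal (3 / 4 * N) ≤
      occupation N ((box L).indicator (fun _ => ((Real.sqrt (L ^ 3))⁻¹ : ℂ))) Ψ.ψ +
        ENNReal.ofReal (1 / 16) * (N : ℝ≥0∞) := by
    rw [← hT0]; exact hT34.trans htele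
  have h16 : ENNReal.ofReal (1 / 16) * (N : ℝ≥0∞) = ENNReal.ofReal (1 / 16 * N) := by
    rw [ENNReal.ofReal_mul (by norm_num), ENNReal.ofReal_natCast]
  rw [h16] at hfin
  have hsub' := tsub_le_iff_right.mpr hfin
  rw [← ENNReal.ofReal_sub _ (by positivity)] at hsub'
  refine le_trans (ENNReal.ofReal_le_ofReal ?_) hsub'
  have hN0 : (0 : ℝ) ≤ N := Nat.cast_nonneg _
  nlinarith

/-- **HONESTY CHECK: the open stub S1″ implies the route's TARGET directly (positive scattering
length), through the kinetic window only.** `HaarBandAboveKineticWindow →` zero-mode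
occupation `≥ N/2` for all `δ(N)`-near-minimisers at small density: the block kinetic bound (K) and the
kinetic budget (E) give `T_{m₀-1} ≥ (1 − 32c₀²/π)N ≥ 3N/4` at the first level `m₀` of side
`≤ s = c₀(ρa)^{-1/2}` (`c₀ < 1/40`), and S1″ telescopes `T_{m₀-1} − n₀ ≤ N(Σβ)² ≤ N/16` over the levels
above `s` (all bracketed once `s ≥ ℓ_d`, i.e. `ρ ≤ c₀²/(aℓ_d²)`). No amplitude chaining, no local
condensation input, no `BaseCoherentMass`. [folklore] -/
theorem zeroMode_of_haarBandAboveKineticWindow (hH : HaarBandAboveKineticWindow) :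
    ∀ v : ℝ → ℝ≥0∞, IsRepulsiveFiniteRange v → 0 < (scatteringLength v).toReal →
      ∃ ρ₀ : ℝ, 0 < ρ₀ ∧ ∀ ρ : ℝ, 0 < ρ → ρ < ρ₀ → ∀ᶠ N : ℕ in atTop,
        ∃ δ : ℝ≥0∞, 0 < δ ∧ ∀ Ψ : TrialState N (sideLength ρ N),
          energy v Ψ ≤ groundStateEnergy v N (sideLength ρ N) + δ →
            ENNReal.ofReal (1 / 2 * N) ≤ occupation N ((box (sideLength ρ N)).indicator
              fun _ => ((Real.sqrt (sideLength ρ N ^ 3))⁻¹ : ℂ)) Ψ.ψ := by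
  intro v hv ha
  set a : ℝ := (scatteringLength v).toReal with ha_def
  have hapos : 0 < scatteringLength v := (ENNReal.toReal_pos_iff.1 ha).1
  obtain ⟨c₀, b, ℓd, hc₀, hb, hcb, hℓd, ρ₁, hρ₁, H1⟩ := hH v hv hapos
  obtain ⟨ρ₂, hρ₂, H2⟩ := stub_kineticBudget v hv hapos 1 one_pos
  have hc40 : c₀ < 1 / 40 := by linarith
  have hb4 : b ≤ 1 / 4 := by linarith
  refine ⟨min ρ₁ (min ρ₂ (c₀ ^ 2 / (a * ℓd ^ 2))), by positivity, fun ρ hρ hρlt => ?_⟩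
  have hρ1 : ρ < ρ₁ := hρlt.trans_le (min_le_left _ _)
  have hρ2 : ρ < ρ₂ := hρlt.trans_le ((min_le_right _ _).trans (min_le_left _ _))
  have hρ3 : ρ < c₀ ^ 2 / (a * ℓd ^ 2) := hρlt.trans_le ((min_le_right _ _).trans (min_le_right _ _))
  obtain ⟨β, hβ0, hβs, hβt, E1⟩ := H1 ρ hρ hρ1
  have E2 := H2 ρ hρ hρ2
  -- the window top `s = c₀ (ρa)^{-1/2}`
  set s : ℝ := c₀ * (ρ * a) ^ (-(1 : ℝ) / 2) with hs_def
  have hρa : 0 < ρ * a := mul_pos hρ ha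
  have hs0 : 0 < s := by positivity
  have hs2 : s ^ 2 = c₀ ^ 2 / (ρ * a) := by
    rw [hs_def, mul_pow, ← Real.rpow_natCast ((ρ * a) ^ (-(1 : ℝ) / 2)) 2, ← Real.rpow_mul hρa.le]
    norm_num
    rw [Real.rpow_neg_one, div_eq_mul_inv]
  have hℓs : ℓd ≤ s := by
    have h1 : ℓd ^ 2 ≤ s ^ 2 := by
      rw [hs2, le_div_iff₀ hρa]
      have := (lt_div_iff₀ (by positivity : 0 < a * ℓd ^ 2)).mp hρ3
      nlinarith
    exact (pow_le_pow_iff_left₀ hℓd.le hs0.le two_ne_zero).1 h1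
  -- eventually the box is larger than the window top
  have hev : ∀ᶠ N : ℕ in atTop, s < sideLength ρ N := by
    have h1 : Tendsto (fun N : ℕ => ((N : ℝ) / ρ) ^ (1 / 3 : ℝ)) atTop atTop :=
      (tendsto_rpow_atTop (by norm_num : (0 : ℝ) < 1 / 3)).comp
        (tendsto_natCast_atTop_atTop.atTop_div_const hρ)
    exact h1.eventually_gt_atTop s
  filter_upwards [E1, E2, hev] with N hN1 hN2 hNL
  clear E1 E2 H1 H2
  dsimp only at hN1 hN2
  generalize hLdef : sideLength ρ N = L at hN1 hN2 hNL ⊢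
  obtain ⟨δ₁, hδ₁, HΨ1⟩ := hN1
  refine ⟨min δ₁ 1, lt_min hδ₁ one_pos, fun Ψ hΨ => ?_⟩
  have hΨ1 := HΨ1 Ψ (hΨ.trans (add_le_add le_rfl (min_le_left _ _)))
  have hKin := hN2 Ψ (hΨ.trans (add_le_add le_rfl (min_le_right _ _)))
  clear HΨ1 hN2
  have hsL : s < L := hNL
  have hLpos : 0 < L := hs0.trans hsL
  -- the kinetic window: mass `≥ 3N/4` at the level just above the first level of side `≤ s`
  have hWL : ∀ m₀ : ℕ, 1 ≤ m₀ → L / 2 ^ m₀ ≤ s → ENNReal.ofReal (3 / 4 * N) ≤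
      ∑ i : Fin 3 → Fin (2 ^ (m₀ - 1)), occupation N (Set.indicator {x : EuclideanSpace ℝ (Fin 3) | ∀ k : Fin 3,
          x k ∈ Set.Ioo (((i k : ℕ) : ℝ) * (L / 2 ^ (m₀ - 1))) ((((i k : ℕ) : ℝ) + 1) * (L / 2 ^ (m₀ - 1)))}
          (fun _ => ((Real.sqrt ((L / 2 ^ (m₀ - 1)) ^ 3))⁻¹ : ℂ))) Ψ.ψ := by
    intro m₀ hm₀pos hm₀s
    obtain ⟨k, rfl⟩ : ∃ k, m₀ = k + 1 := ⟨m₀ - 1, by omega⟩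
    rw [Nat.add_sub_cancel]
    have hK := stub_blockKineticBound N L Ψ k
    dsimp only at hK
    -- the kinetic remainder is at most `N/4`
    have hside : L / 2 ^ k = 2 * (L / 2 ^ (k + 1)) := by
      rw [pow_succ]; field_simp
    have hside' : L / 2 ^ k ≤ 2 * s := by rw [hside]; linarith
    have hsnn : 0 ≤ L / 2 ^ k := by positivity
    have hN0 : (0 : ℝ) ≤ N := Nat.cast_nonneg _
    have hrem : ENNReal.ofReal ((L / 2 ^ k) ^ 2 / Real.pi ^ 2) * ∫⁻ X, kineticDensity Ψ.ψ X ≤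
        ENNReal.ofReal (1 / 4 * N) := by
      calc ENNReal.ofReal ((L / 2 ^ k) ^ 2 / Real.pi ^ 2) * ∫⁻ X, kineticDensity Ψ.ψ X
          ≤ ENNReal.ofReal ((L / 2 ^ k) ^ 2 / Real.pi ^ 2) *
              ENNReal.ofReal (4 * Real.pi * a * ρ * (1 + 1) * N) := mul_le_mul' le_rfl hKin
        _ = ENNReal.ofReal ((L / 2 ^ k) ^ 2 / Real.pi ^ 2 * (4 * Real.pi * a * ρ * (1 + 1) * N)) := by
              rw [← ENNReal.ofReal_mul (by positivity)]
        _ ≤ ENNReal.ofReal (1 / 4 * N) := by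
              refine ENNReal.ofReal_le_ofReal ?_
              have h1 : (L / 2 ^ k) ^ 2 ≤ (2 * s) ^ 2 := pow_le_pow_left₀ hsnn hside' 2
              have h2 : (2 * s) ^ 2 * (a * ρ) = 4 * c₀ ^ 2 := by
                rw [mul_pow, hs2]; field_simp; ring
              have hpi3 : (3 : ℝ) < Real.pi := Real.pi_gt_three
              have hpi0 : 0 < Real.pi := Real.pi_pos
              -- `(L/2^k)²/π² · 8πaρN ≤ (2s)² · 8aρN/π = 32 c₀² N/π ≤ N/4`
              calc (L / 2 ^ k) ^ 2 / Real.pi ^ 2 * (4 * Real.pi * a * ρ * (1 + 1) * N)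
                  = (L / 2 ^ k) ^ 2 * (a * ρ) * N * (8 / Real.pi) := by
                      field_simp; ring
                _ ≤ (2 * s) ^ 2 * (a * ρ) * N * (8 / Real.pi) := by gcongr
                _ = 32 * c₀ ^ 2 * N / Real.pi := by rw [h2]; ring
                _ ≤ 1 / 4 * N := by
                      rw [div_le_iff₀ hpi0]
                      have hc2 : c₀ ^ 2 ≤ (1 / 40) ^ 2 := pow_le_pow_left₀ hc₀.le hc40.le 2
                      nlinarith
    have hK' : (N : ℝ≥0∞) ≤ (∑ i : Fin 3 → Fin (2 ^ k), occupation N (Set.indicator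
        {x : EuclideanSpace ℝ (Fin 3) | ∀ k' : Fin 3, x k' ∈ Set.Ioo (((i k' : ℕ) : ℝ) * (L / 2 ^ k))
          ((((i k' : ℕ) : ℝ) + 1) * (L / 2 ^ k))} (fun _ => ((Real.sqrt ((L / 2 ^ k) ^ 3))⁻¹ : ℂ))) Ψ.ψ) +
        ENNReal.ofReal (1 / 4 * N) := hK.trans (add_le_add le_rfl hrem)
    have hsplit : (N : ℝ≥0∞) = ENNReal.ofReal (3 / 4 * N) + ENNReal.ofReal (1 / 4 * N) := by
      rw [← ENNReal.ofReal_add (by positivity) (by positivity), ← ENNReal.ofReal_natCast]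
      congr 1; ring
    rw [hsplit] at hK'
    exact ENNReal.le_of_add_le_add_right ENNReal.ofReal_ne_top hK'
  exact zeroMode_core' Ψ hℓd hℓs hs0 hsL hβ0 hβs (hβt.trans hb4) hΨ1 hWL


/-! ## Hardness certificates (lead c3, LANDED p156875): the open stub and the crux imply the CONJUNCT -/

/-- The open stub S1″ implies the sub-problem statement `BoseEinsteinCondensation` (tree theorem
`boseEinsteinCondensation_of_haarBandAboveKineticWindow`, via the composition and `BaseCoherentMass`). [folklore] -/
theorem conjunct_of_stub : __Goal.stub_haarBandAboveKineticWindow → _root_.BoseEinsteinCondensation :=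
  fun hH => boseEinsteinCondensation_of_haarBandAboveKineticWindow hH

/-- The crux implies the sub-problem statement (tree theorem `boseEinsteinCondensation_of_dyadicCoherenceDefect`). [folklore] -/
theorem conjunct_of_crux : BECDyadicChaining.DyadicCoherenceDefect → _root_.BoseEinsteinCondensation :=
  boseEinsteinCondensation_of_dyadicCoherenceDefect

/-- The crux implies the route target X_B1 (tree theorem `zeroModeOccupation_of_dyadicCoherenceDefect`). [folklore] -/
theorem target_of_crux : BECDyadicChaining.DyadicCoherenceDefect → BECDyadicChaining.ZeroModeOccupation :=
  zeroModeOccupation_of_dyadicCoherenceDefect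

end Summit.AtomisticToContinuum.BoseEinsteinCondensation.Cruxes.DyadicCoherenceDefect.Birth

end
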